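import Literature.AlgebraicGeometry.HodgeTheory.ThomGysinClosedImmersion
import Literature.AlgebraicGeometry.HodgeTheory.TopDegreeClasses
import Literature.AlgebraicTopology.SingularHomology.CohomologyVanishingNearUnion
import Literature.AlgebraicTopology.SingularHomology.CompactGroupExteriorCohomology
import HarnessLib

/-!
# Deligne's Prop. 8.2.7 in Čech form for a finite family of concurrent smooth closed subvarieties, and the span of their classes

Family `hodge`, layer `Literature/AlgebraicGeometry/HodgeTheory`. PROOF FILE (theorems only; no
definition, no named fact). The tree's `ker_restrictCompl_le_iSup_range_complexGysin_of_pullback`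
(`ThomGysinClosedImmersion`; Deligne, *Hodge III*, Cor. 8.2.8 `⊆` transposed by Poincaré duality)
takes as hypothesis Prop. 8.2.7 in Čech form: a class killed by all the pull-backs `(g j)(ℂ)^*`
vanishes on an open neighbourhood of `⋃ j, g_j(Y j)(ℂ)`. The tree verified it for THREE closed
immersions whose images pairwise meet in one common complex point (`hypothesisH_of_concurrent`,
`FermatCubicSurfaceLineClasses`: the three lines of a tritangent plane of the Fermat cubic). Here:

* `hypothesisH_of_concurrent_family` — **the same for any FINITE family** `g j : Y j ⟶ X`
  (`j : ι`, `ι` finite) of closed immersions of smooth projective varieties whose images pairwise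
  meet (on complex points) only in one common point `P₀`: induction on finite subfamilies, patching
  the neighbourhood of `⋃_{j ∈ s} g_j(Y j)(ℂ)` and the taut neighbourhood of the next image across a
  small acyclic ball at `P₀` (`singularCohomology.exists_isOpen_union_map_subsetIncl_eq_zero`,
  Mayer–Vietoris, Hatcher §3.1 pp. 203–204);
* `exists_eq_sum_smul_complexGysin_one_of_concurrent` — **consequently every class of
  `Hᵇ(X(ℂ); ℂ)`, `b = 2(n - m)`, dying off `⋃ j, g_j(Y j)` is a linear combination
  `Σ_j s_j (g j)_* 1` of the classes of the `Y j`** (all of dimension `m`, `0 < n - m < n`; the Gysin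
  sources are `H⁰(Y j(ℂ)) = ℂ · 1`, the `Y j(ℂ)` being connected) — e.g. the `m` concurrent lines
  `x₀ = ε x₁, x₂ = ε' x₃` (`ε'ᵐ = -1`) cut on the Fermat surface of degree `m` by the plane `x₀ = ε x₁`
  (Shioda, Math. Ann. 245 (1979) §1; for `m = 3` the tritangent planes, Hartshorne V Ex. 4.16).

## References

* [DeligneHodgeIII1974] P. Deligne, Théorie de Hodge III, Publ. Math. IHÉS 44 (1974), Prop. 8.2.7,
  Cor. 8.2.8.
* [HatcherAT2002] A. Hatcher, Algebraic Topology, CUP 2002, §3.1 pp. 199, 203–204.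
* [Shioda1979HodgeFermat] T. Shioda, The Hodge conjecture for Fermat varieties, Math. Ann. 245 (1979), §1.
-/

noncomputable section

open CategoryTheory AlgebraicGeometry
open Literature.AlgebraicTopology.SingularHomology

namespace Literature.AlgebraicGeometry.HodgeTheory

section HodgeTheory

open Literature.AlgebraicGeometry.Motives

variable {n : ℕ} {X : Motives.SchemeOver ℂ}

/-- **Deligne's Prop. 8.2.7 in Čech form for a finite family of closed immersions whose images
pairwise meet in one common complex point.** For `X` smooth projective, closed immersions
`g j : Y j ⟶ X` (`j : ι`, `ι` finite) of smooth projective `Y j`, and a complex point `P₀` on all the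
images such that any two images meet (on complex points) only in `P₀`: every class
`x' ∈ H^{p+1}(X(ℂ); ℂ)` (`p ≠ 0`) killed by all the `(g j)(ℂ)^*` vanishes on an open neighbourhood of
`⋃ j, g_j(Y j)(ℂ)`. Proof: tautness gives such a neighbourhood of each image separately
(`exists_isOpen_map_subsetIncl_eq_zero_of_isClosedImmersion`); by induction on finite subfamilies
the neighbourhoods are patched two at a time across a small acyclic ball around `P₀`
(`singularCohomology.exists_isOpen_union_map_subsetIncl_eq_zero`, Mayer–Vietoris).
[cite: DeligneHodgeIII1974, Prop. 8.2.7] [cite: HatcherAT2002, §3.1 pp. 203–204] -/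
theorem hypothesisH_of_concurrent_family (hX : IsSmoothProjective n X) {ι : Type} [Finite ι]
    {m : ι → ℕ} {Y : ι → Motives.SchemeOver ℂ} (hY : ∀ j, IsSmoothProjective (m j) (Y j))
    (g : ∀ j, Y j ⟶ X) [∀ j, IsClosedImmersion (g j).left] (P₀ : ComplexPoints X)
    (hP₀ : ∀ j, P₀.pt ∈ Set.range (g j).left.base)
    (hmeet : ∀ i j, i ≠ j → ∀ P : ComplexPoints X,
      P.pt ∈ Set.range (g i).left.base → P.pt ∈ Set.range (g j).left.base → P = P₀)
    {p : ℕ} (hp : p ≠ 0) (x' : complexBetti X (p + 1))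
    (hx' : ∀ j, complexBetti.map (g j) (p + 1) x' = 0) :
    ∃ V : Set (ComplexPoints X), IsOpen V ∧
      {P | P.pt ∈ ⋃ j, Set.range (g j).left.base} ⊆ V ∧
      singularCohomology.map ℂ ℂ (subsetIncl V) (p + 1) x' = 0 := by
  classical
  letI := hX.chartedSpace
  haveI := ComplexPoints.compactSpace_of_isSmoothProjective hX
  haveI := ComplexPoints.t2Space_of_isSmoothProjective hX
  obtain ⟨_i⟩ := nonempty_fintype ι
  -- tautness of each image
  have hV : ∀ j, ∃ V : Set (ComplexPoints X), IsOpen V ∧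
      {P | P.pt ∈ Set.range (g j).left.base} ⊆ V ∧
      singularCohomology.map ℂ ℂ (subsetIncl V) (p + 1) x' = 0 :=
    fun j ↦ exists_isOpen_map_subsetIncl_eq_zero_of_isClosedImmersion hX (hY j) (g j) x' (hx' j)
  choose V hVo hKV hVx using hV
  set K : ι → Set (ComplexPoints X) := fun j ↦ {P | P.pt ∈ Set.range (g j).left.base} with hK
  have hKc : ∀ j, IsCompact (K j) :=
    fun j ↦ (isClosed_setOf_pt_mem (g j).left.isClosedEmbedding.isClosed_range).isCompact
  have hPK : ∀ j, P₀ ∈ K j := hP₀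
  have hKK : ∀ i j, i ≠ j → K i ∩ K j ⊆ {P₀} :=
    fun i j hij P hP ↦ Set.mem_singleton_iff.mpr (hmeet i j hij P hP.1 hP.2)
  -- induction on finite subfamilies, keeping `P₀` inside the neighbourhood
  have key : ∀ s : Finset ι, ∃ W : Set (ComplexPoints X), IsOpen W ∧ P₀ ∈ W ∧
      (⋃ j ∈ s, K j) ⊆ W ∧ singularCohomology.map ℂ ℂ (subsetIncl W) (p + 1) x' = 0 := by
    intro s
    induction s using Finset.induction_on with
    | empty =>
      obtain ⟨B, hBo, hPB, -, hBZ⟩ := singularCohomology.exists_isOpen_subset_isZero_of_chartedSpace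
        (R := ℂ) (d := 2 * n) P₀ (U := Set.univ) Filter.univ_mem (p := p + 1) (Nat.succ_ne_zero p)
      refine ⟨B, hBo, hPB, by simp, ?_⟩
      exact (ModuleCat.subsingleton_of_isZero hBZ).elim _ _
    | insert i s hi ih =>
      obtain ⟨W, hWo, hPW, hKW, hWx⟩ := ih
      have hKc' : IsCompact (⋃ j ∈ s, K j) := s.isCompact_biUnion fun j _ ↦ hKc j
      have hKK' : (⋃ j ∈ s, K j) ∩ K i ⊆ {P₀} := by
        rintro P ⟨hP, hPi⟩
        simp only [Set.mem_iUnion] at hP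
        obtain ⟨j, hj, hPj⟩ := hP
        exact hKK j i (fun h ↦ hi (h ▸ hj)) ⟨hPj, hPi⟩
      obtain ⟨B, hBo, hPB, hBV, hBZ⟩ := singularCohomology.exists_isOpen_subset_isZero_of_chartedSpace
        (R := ℂ) (d := 2 * n) P₀ (U := W ∩ V i) ((hWo.inter (hVo i)).mem_nhds ⟨hPW, hKV i (hPK i)⟩) hp
      obtain ⟨W', hW'o, hKW', hW'x⟩ := singularCohomology.exists_isOpen_union_map_subsetIncl_eq_zero ℂ
        hKc' (hKc i) hKK' x' hWo (hVo i) hKW (hKV i) hWx (hVx i) hBo hPB hBV hBZ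
      refine ⟨W', hW'o, hKW' (Or.inr (hPK i)), fun P hP ↦ hKW' ?_, hW'x⟩
      rw [Finset.set_biUnion_insert] at hP
      rcases hP with hP | hP
      exacts [Or.inr hP, Or.inl hP]
  obtain ⟨W, hWo, -, hKW, hWx⟩ := key Finset.univ
  refine ⟨W, hWo, fun P hP ↦ hKW ?_, hWx⟩
  simp only [Set.mem_setOf_eq, Set.mem_iUnion] at hP
  obtain ⟨j, hj⟩ := hP
  exact Set.mem_biUnion (Finset.mem_univ j) hj

/-- **The classes of a finite family of concurrent smooth closed subvarieties span the classes
dying off their union.** For `X` smooth projective of dimension `n`, closed immersions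
`g j : Y j ⟶ X` (`j : ι`, `ι` finite) of smooth projective `Y j` of dimension `m = n - c`
(`2c + (p + 1) = 2n` with `p ≠ 0`, i.e. `0 < c < n`) whose images pairwise meet only in one common
complex point, every `x ∈ H²ᶜ(X(ℂ); ℂ)` whose restriction to `(X ∖ ⋃ j, g_j(Y j))(ℂ)` vanishes
is `Σ_j s_j • (g j)_* 1` for some scalars `s` (Deligne's Cor. 8.2.8 `⊆`,
`ker_restrictCompl_le_iSup_range_complexGysin_of_pullback`, fed with
`hypothesisH_of_concurrent_family`; the Gysin sources are `H⁰(Y j(ℂ); ℂ) = ℂ · 1`, the `Y j(ℂ)` being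
path connected). [cite: DeligneHodgeIII1974, Cor. 8.2.8] [cite: HatcherAT2002, §3.1 p. 199] -/
theorem exists_eq_sum_smul_complexGysin_one_of_concurrent (μ : OrientationFamily)
    (hX : IsSmoothProjective n X) {ι : Type} [Fintype ι] {m : ℕ} {Y : ι → Motives.SchemeOver ℂ}
    (hY : ∀ j, IsSmoothProjective m (Y j)) (g : ∀ j, Y j ⟶ X) [∀ j, IsClosedImmersion (g j).left]
    (P₀ : ComplexPoints X) (hP₀ : ∀ j, P₀.pt ∈ Set.range (g j).left.base)
    (hmeet : ∀ i j, i ≠ j → ∀ P : ComplexPoints X,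
      P.pt ∈ Set.range (g i).left.base → P.pt ∈ Set.range (g j).left.base → P = P₀)
    {c p : ℕ} (hp : p ≠ 0) (hcp : 2 * c + (p + 1) = 2 * n) (hcm : 0 + 2 * n = 2 * c + 2 * m)
    (x : complexBetti X (2 * c))
    (hx : complexBetti.restrictCompl X (⋃ j, Set.range (g j).left.base) (2 * c) x = 0) :
    ∃ s : ι → ℂ, x = ∑ j, s j • complexGysin μ (hY j) hX (g j) hcm
      (singularCohomology.one ℂ (ComplexPoints (Y j))) := by
  have key := ker_restrictCompl_le_iSup_range_complexGysin_of_pullback μ hX (m := fun _ ↦ m) hY g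
    (b := 2 * c) (q := p + 1) hcp
    (hypothesisH_of_concurrent_family hX (m := fun _ ↦ m) hY g P₀ hP₀ hmeet hp)
  have hmem := key (LinearMap.mem_ker.mpr hx)
  have hle : (⨆ (j : ι) (a' : ℕ) (hab : a' + 2 * n = 2 * c + 2 * m),
      LinearMap.range (complexGysin μ (hY j) hX (g j) hab)) ≤
      Submodule.span ℂ (Set.range fun j : ι ↦ complexGysin μ (hY j) hX (g j) hcm
        (singularCohomology.one ℂ (ComplexPoints (Y j)))) := by
    refine iSup_le fun j ↦ iSup_le fun a' ↦ iSup_le fun hab ↦ ?_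
    obtain rfl : a' = 0 := by omega
    rintro _ ⟨y, rfl⟩
    haveI := connectedSpace_complexPoints (hY j)
    letI := (hY j).chartedSpace
    haveI := ChartedSpace.locallyPathConnectedSpace (H := EuclideanSpace ℝ (Fin (2 * m)))
      (M := ComplexPoints (Y j))
    haveI : PathConnectedSpace (ComplexPoints (Y j)) :=
      pathConnectedSpace_iff_connectedSpace.2 inferInstance
    rw [singularCohomology.eq_smul_one ℂ y, map_smul]
    exact Submodule.smul_mem _ _ (Submodule.subset_span ⟨j, rfl⟩)
  exact (Submodule.mem_span_range_iff_exists_fun ℂ).mp (hle hmem) |>.imp fun s hs ↦ hs.symm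

end HodgeTheory

end Literature.AlgebraicGeometry.HodgeTheory

end
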